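/-
Copyright (c) 2026 the pub-hodgecm-mathlib formalisation cell (harness21).  Prover seat hodgecm-mathlib-K2Liu-p08 (g5), Track B «K2-LIT»,
#184♮ = hLiu418 = `stmt-HodgeConjecture-24832`; #42S organ S1, (G) organ ROW (ρ-mid): THE TWO SIEGEL LETTERS EVERY CONSUMER OF THE (C3) LEVI ROW NEEDS —
`x = n(t)·m` (`m ∈ M_Δ`) for `x ∈ P_Δ`, and the block-side skew `tb` with `P_v tb P_v⁻¹ = reindex (t ⊗ₖ 1)` (the (M1) letter `hPX`).
-/
import Summits.HodgeConjecture.HodgeConjecture.Theorems.K2LiuTensorMiddleCellHaarDelta       -- ★ (C2b′) letters (`hPX`, `htb` shapes), ★ `skew_reindex_kronecker_one`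
import Summits.HodgeConjecture.HodgeConjecture.Theorems.K2LiuSiegelDeltaLeviUnipotent        -- ★ `exists_levi_mul_nElem` (`p = m · n(t)`)
import Summits.HodgeConjecture.HodgeConjecture.Theorems.K2LiuA7ValueInstanceDefs             -- ★ `leviDeltaLoc` (`M_Δ`)
import Literature.NumberTheory.K2Lit.LocalDoublingSiegel                                   -- ★ `siegelDeltaLoc`, `mem_siegelDeltaLoc_iff_local`
import HarnessLib

/-!
# Crux `HLiu418`, #42S organ S1, (ρ-mid): THE SIEGEL LETTERS OF THE (C3) CONSUMERS — `P_Δ ∋ x = n(t) · m`, `m ∈ M_Δ`, AND THE BLOCK-SIDE SKEW `tb`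

Cell `hodgecm-mathlib`, crux item hLiu418 = `stmt-HodgeConjecture-24832`; squad K2 ∕ K2Liu; LEAD F0P6-plan (g14); prover K2Liu-p08 (g5).
THEOREMS ONLY (no `def`, no instance, no notation, no named-fact hypothesis, no `sorry`); lane `--supports stmt-HodgeConjecture-24832 --as helper`.

WHY.  The (C3) Levi row ★ p862499 `K2LiuTensorMiddleCellLeviRow.exists_ne_zero_swSectionTensorLoc_flip_mul_nElem_mul_eq_integral_levi` is quantified as
`∀ t ht tb htb hPX Ψ k hk B hB, F_Ψ(w₁ · (n(t) · k)) = …`: it evaluates the middle cell at `n(t)·k` with `k` Siegel and the Levi letter `hB` by value (★ (C3-b) p862528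
pays `∃ B, hB` for `k ∈ M_Δ = leviDeltaLoc`), and it wants, besides the skew `t` of `U(𝕍^𝔻)(L⁺_v)`, a BLOCK-SIDE skew `tb` of the frame datum `T₁ ⊕ᶠ T₂` with
`P_v tb P_v⁻¹ = reindex epsV (t ⊗ₖ 1)` (the (M1) letter `hPX` of ★ `swSectionTensorLoc_flip_mul_nElem_eq_block`).  The faces' `hmid` rows run over ALL `x ∈ P_Δ`
(★ `K2LiuLocalSWSpanningSplitOfMoverMiddleRowsGeneral`, ★ p862306, ★ p862047's `hfac±`).  THIS FILE supplies the two letters every evaluation hand (inert ∕ ramified F0P2-p07,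
split K2Liu-p08) needs to read the (C3) row at an arbitrary `x ∈ P_Δ`:
* §1 **`exists_nElem_mul_mem_leviDeltaLoc`** — every `x ∈ P_Δ(L⁺_v)` is `n(t) · m` with `t` skew and `m ∈ M_Δ` (★ `exists_levi_mul_nElem` gives the OTHER order
  `x⁻¹ = m′ · n(t′)`; invert with ★ `nElem_inv`: `x = n(−t′) · m′⁻¹`, `M_Δ` a subgroup);
* §2 **`exists_blockSkew`** — for a skew `t` there is a block-side skew `tb := P_v⁻¹ · reindex epsV (t ⊗ₖ 1) · P_v` with `hPX` on the nose; skewness for the block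
  Gram `T₁ ⊕ᶠ T₂ = Pᵀ · gramR(𝕍 ⊗ V′) · P` (`hP`) transports from ★ `skew_reindex_kronecker_one` because `P` is RATIONAL (`σ` fixes `P_v`, ★ `conjLocal_toLocalRing`).
References: [Kudla1994] §3 Thm. 3.1; [Weil1964] n° 32; [MoeglinVignerasWaldspurger1987] Chap. 2 II.6; [HarrisKudlaSweet1996] §1 (1.11).
HONEST LABEL.  Count-neutral helper: `HC_CM` is proved only modulo the 7 printed citations (2 remaining named inputs: hLiu418 = `stmt-HodgeConjecture-24832`,
h413 = `stmt-HodgeConjecture-24833`) until rung 0 closes.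

## References
* [Kudla1994] S. S. Kudla, Israel J. Math. 87 (1994), §3 Thm. 3.1.  * [Weil1964] A. Weil, Acta Math. 111 (1964), n° 32.
* [MoeglinVignerasWaldspurger1987] C. Mœglin, M.-F. Vignéras, J.-L. Waldspurger, LNM 1291 (1987), Chap. 2 II.6.
* [HarrisKudlaSweet1996] M. Harris, S. Kudla, W. J. Sweet, J. Amer. Math. Soc. 9 (1996), §1 (1.11).
-/

set_option autoImplicit false
set_option linter.dupNamespace false -- the mandated namespace repeats `HodgeConjecture.HodgeConjecture`

noncomputable section

open scoped Matrix Kronecker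
open NumberField IsDedekindDomain Matrix
open Literature.NumberTheory.Automorphic Literature.NumberTheory.Automorphic.UnitaryGroup Literature.NumberTheory.Weil1964
open Literature.NumberTheory.GelbartRogawski1991 Literature.NumberTheory.GelbartRogawski1991.GRConstruction
open Literature.NumberTheory.GelbartRogawski1991.AdaptedBlocks
open Literature.NumberTheory.GelbartRogawski1991.UnitaryDualPair
open Literature.NumberTheory.GelbartRogawski1991.UnitaryDualPair.LocalSplitting
open Literature.NumberTheory.K2Lit.SiegelDoubled Literature.NumberTheory.K2Lit.LocalSiegelDoubled
open Summit.HodgeConjecture.HodgeConjecture.Cruxes.HLiu418.K2LiuLocalSWTensorBigCellLetters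
open Summit.HodgeConjecture.HodgeConjecture.Cruxes.HLiu418.K2LiuSiegelDeltaLeviUnipotent
open Summit.HodgeConjecture.HodgeConjecture.Cruxes.HLiu418.K2LiuA7ValueInstanceDefs

namespace Summit.HodgeConjecture.HodgeConjecture.Cruxes.HLiu418.K2LiuTensorMiddleCellSiegelLetters

variable (L : Type) [Field L] [NumberField L] [IsCMField L]
variable {N M n : ℕ} (e : Fin N × Fin M ≃ Fin n)
  (dV : Fin N → L) (hdV : ∀ i, IsCMField.complexConj L (dV i) = dV i)
  (dW : Fin M → L) (hdW : ∀ i, IsCMField.complexConj L (dW i) = dW i)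
  (v : HeightOneSpectrum (𝓞 (Fp L)))

/-! ## §1 `P_Δ ∋ x = n(t) · m` with `m ∈ M_Δ` -/

set_option maxHeartbeats 800000 in -- MEASURED: default times out at `whnf` (`x⁻¹` in `U(𝔻)(L⁺_v)` over `L ⊗ L⁺_v`, as ★ `K2LiuA7ValueInstanceDefs.blkBC_inv_eq_zero`)
/-- **EVERY `x ∈ P_Δ(L⁺_v)` IS `n(t) · m` WITH `m ∈ M_Δ`** (unipotent FIRST, the order of the (C3) Levi row `F_Ψ(w₁ · (n(t) · k))`): apply ★ `exists_levi_mul_nElem`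
(`p = m′ · n(t′)`) to `x⁻¹ ∈ P_Δ` and invert — `x = n(t′)⁻¹ · m′⁻¹ = n(−t′) · m′⁻¹` (★ `nElem_inv`), `m′⁻¹ ∈ M_Δ` (★ `leviDeltaLoc` is a subgroup; `m′` has `B = 0` and,
being Siegel, `C = 0` by ★ `isSiegelDelta_iff_blkC_eq_zero`). [cite: Kudla1994, §3 Thm. 3.1] [cite: Weil1964, n° 32] [cite: MoeglinVignerasWaldspurger1987, Chap. 2 II.6] -/
theorem exists_nElem_mul_mem_leviDeltaLoc (x : UnitaryGroup.localPi L (IsCMField.complexConj L) (n + n) (hermD L e dV hdV dW hdW) v)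
    (hx : x ∈ siegelDeltaLoc L e dV hdV dW hdW v) :
    ∃ (t : Matrix (Fin n) (Fin n) (LocalRing L v))
      (ht : (t.map (conjLocal L (IsCMField.complexConj L) v))ᵀ * gramS (Fp L) L v n (gramR L e dV hdV dW hdW) +
        gramS (Fp L) L v n (gramR L e dV hdV dW hdW) * t = 0)
      (m : UnitaryGroup.localPi L (IsCMField.complexConj L) (n + n) (hermD L e dV hdV dW hdW) v),
      m ∈ leviDeltaLoc L e dV hdV dW hdW v ∧
        x = nElem (Fp L) L (IsCMField.complexConj L) v n (T₀ := gramR L e dV hdV dW hdW) (hermD_eq_map_gramD L e dV hdV dW hdW) t ht * m := by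
  haveI : Algebra.IsQuadraticExtension (Fp L) L := IsCMField.isQuadraticExtension L
  have hx' := (mem_siegelDeltaLoc_iff_local L e dV hdV dW hdW v x⁻¹).1 (inv_mem hx)
  obtain ⟨m, hm, hB, -, -, heq⟩ := exists_levi_mul_nElem (Fp L) L (IsCMField.complexConj L) (complexConj_imagUnit L) (imagUnit_ne_zero L)
    (imagUnit_mul_self L) v n (gramR_isSymm L e dV hdV dW hdW) (hermD_eq_map_gramD L e dV hdV dW hdW) x⁻¹ hx'
  have hC : blkC (matA (Fp L) L (IsCMField.complexConj L) v n m) = 0 :=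
    (isSiegelDelta_iff_blkC_eq_zero (Fp L) L (IsCMField.complexConj L) (complexConj_imagUnit L) (imagUnit_ne_zero L) (imagUnit_mul_self L) v n
      (gramR_isSymm L e dV hdV dW hdW) (hermD_eq_map_gramD L e dV hdV dW hdW) m).1 hm
  have hmM : m ∈ leviDeltaLoc L e dV hdV dW hdW v := (mem_leviDeltaLoc_iff L e dV hdV dW hdW v m).2 ⟨hB, hC⟩
  refine ⟨-((blkA (matA (Fp L) L (IsCMField.complexConj L) v n x⁻¹))⁻¹ * blkB (matA (Fp L) L (IsCMField.complexConj L) v n x⁻¹)),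
    skew_neg (Fp L) L (IsCMField.complexConj L) v n (skew_inv_blkA_mul_blkB (Fp L) L (IsCMField.complexConj L) (complexConj_imagUnit L) (imagUnit_ne_zero L)
      (imagUnit_mul_self L) v n (gramR_isSymm L e dV hdV dW hdW) (hermD_eq_map_gramD L e dV hdV dW hdW) x⁻¹ hx'),
    m⁻¹, inv_mem hmM, ?_⟩
  rw [← nElem_inv (Fp L) L (IsCMField.complexConj L) v n (hermD_eq_map_gramD L e dV hdV dW hdW) _
      (skew_inv_blkA_mul_blkB (Fp L) L (IsCMField.complexConj L) (complexConj_imagUnit L) (imagUnit_ne_zero L) (imagUnit_mul_self L) v n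
        (gramR_isSymm L e dV hdV dW hdW) (hermD_eq_map_gramD L e dV hdV dW hdW) x⁻¹ hx'),
    ← _root_.mul_inv_rev, ← heq, inv_inv]

/-! ## §2 The block-side skew `tb` with `P_v tb P_v⁻¹ = reindex (t ⊗ₖ 1)` -/

section Block

variable {M₂ M' : ℕ} (eW : Fin M × Fin M₂ ≃ Fin M') (e' : Fin N × Fin M' ≃ Fin (M₂ + M₂))
  (dV' : Fin M₂ → L) (hdV' : ∀ k, IsCMField.complexConj L (dV' k) = dV' k)
  {T₁ T₂ : Matrix (Fin M₂) (Fin M₂) (Fp L)} (P : GL (Fin (M₂ + M₂)) (Fp L))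
  (hP : ((P : Matrix (Fin (M₂ + M₂)) (Fin (M₂ + M₂)) (Fp L)))ᵀ *
      gramR L e' dV hdV (tensorFrame L dW eW dV') (tensorFrame_real L dW hdW eW dV' hdV') * (P : Matrix _ _ (Fp L)) =
    UnitaryGroup.finSum M₂ M₂ T₁ T₂)

include hP in
/-- the block Gram over `E ⊗ F_v`: `gramS (T₁ ⊕ᶠ T₂) = P_vᵀ · gramS (gramR(𝕍 ⊗ V′)) · P_v` (`hP` read through the ring map `L⁺ → L⁺_v → L ⊗ L⁺_v`).
[cite: HarrisKudlaSweet1996, §1 (1.11)] -/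
theorem gramS_finSum_eq_conj_gramS_tensor :
    gramS (Fp L) L v (M₂ + M₂) (UnitaryGroup.finSum M₂ M₂ T₁ T₂) =
      ((P : Matrix (Fin (M₂ + M₂)) (Fin (M₂ + M₂)) (Fp L)).map ((UnitaryGroup.toLocalRing L v).comp (algebraMap (Fp L) (v.adicCompletion (Fp L)))))ᵀ *
        gramS (Fp L) L v (M₂ + M₂) (gramR L e' dV hdV (tensorFrame L dW eW dV') (tensorFrame_real L dW hdW eW dV' hdV')) *
        (P : Matrix (Fin (M₂ + M₂)) (Fin (M₂ + M₂)) (Fp L)).map ((UnitaryGroup.toLocalRing L v).comp (algebraMap (Fp L) (v.adicCompletion (Fp L)))) := by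
  have hg : ∀ X : Matrix (Fin (M₂ + M₂)) (Fin (M₂ + M₂)) (Fp L), LocalSplitting.gramS (Fp L) L v (M₂ + M₂) X =
      X.map ((UnitaryGroup.toLocalRing L v).comp (algebraMap (Fp L) (v.adicCompletion (Fp L)))) := fun X => by
    show (X.map _).map _ = _
    rw [Matrix.map_map]
    rfl
  rw [hg, hg, ← hP, Matrix.map_mul, Matrix.map_mul, Matrix.transpose_map]

/-- a rational matrix read in `E ⊗ F_v` is fixed by `σ = c ⊗ 1` (★ `conjLocal_toLocalRing`). [cite: HarrisKudlaSweet1996, §1 (1.11)] -/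
theorem map_conjLocal_of_rational (Q : Matrix (Fin (M₂ + M₂)) (Fin (M₂ + M₂)) (Fp L)) :
    (Q.map ((UnitaryGroup.toLocalRing L v).comp (algebraMap (Fp L) (v.adicCompletion (Fp L))))).map (conjLocal L (IsCMField.complexConj L) v) =
      Q.map ((UnitaryGroup.toLocalRing L v).comp (algebraMap (Fp L) (v.adicCompletion (Fp L)))) := by
  ext i j
  simp only [Matrix.map_apply, RingHom.comp_apply, conjLocal_toLocalRing]

include hP in
/-- **THE BLOCK-SIDE SKEW `tb`** (the (M1) letters `htb`, `hPX` of ★ `swSectionTensorLoc_flip_mul_nElem_eq_block` ∕ ★ (C2b′) ∕ ★ (C3) §2): for a skew `t` of `U(𝕍^𝔻)(L⁺_v)`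
there is `tb := P_v⁻¹ · reindex epsV (t ⊗ₖ 1) · P_v`, skew for the block Gram `T₁ ⊕ᶠ T₂`, with `P_v tb P_v⁻¹ = reindex epsV (t ⊗ₖ 1)` — skewness of `t ⊗ 1` is ★
`skew_reindex_kronecker_one`, and `σ` fixes the rational frame `P_v`. [cite: Kudla1994, §3 Thm. 3.1] [cite: HarrisKudlaSweet1996, §1 (1.11)] -/
theorem exists_blockSkew (t : Matrix (Fin n) (Fin n) (LocalRing L v))
    (ht : (t.map (conjLocal L (IsCMField.complexConj L) v))ᵀ * gramS (Fp L) L v n (gramR L e dV hdV dW hdW) + gramS (Fp L) L v n (gramR L e dV hdV dW hdW) * t = 0) :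
    ∃ (tb : Matrix (Fin (M₂ + M₂)) (Fin (M₂ + M₂)) (LocalRing L v)),
      (tb.map (conjLocal L (IsCMField.complexConj L) v))ᵀ * gramS (Fp L) L v (M₂ + M₂) (UnitaryGroup.finSum M₂ M₂ T₁ T₂) +
          gramS (Fp L) L v (M₂ + M₂) (UnitaryGroup.finSum M₂ M₂ T₁ T₂) * tb = 0 ∧
      (P : Matrix (Fin (M₂ + M₂)) (Fin (M₂ + M₂)) (Fp L)).map ((UnitaryGroup.toLocalRing L v).comp (algebraMap (Fp L) (v.adicCompletion (Fp L)))) * tb *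
          ((P⁻¹ : GL (Fin (M₂ + M₂)) (Fp L)) : Matrix (Fin (M₂ + M₂)) (Fin (M₂ + M₂)) (Fp L)).map
            ((UnitaryGroup.toLocalRing L v).comp (algebraMap (Fp L) (v.adicCompletion (Fp L)))) =
        Matrix.reindex (epsV e eW e') (epsV e eW e') (t ⊗ₖ (1 : Matrix (Fin M₂) (Fin M₂) (LocalRing L v))) := by
  set φ := (UnitaryGroup.toLocalRing L v).comp (algebraMap (Fp L) (v.adicCompletion (Fp L))) with hφ
  set Pv : Matrix (Fin (M₂ + M₂)) (Fin (M₂ + M₂)) (LocalRing L v) := (P : Matrix (Fin (M₂ + M₂)) (Fin (M₂ + M₂)) (Fp L)).map φ with hPv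
  set Pi : Matrix (Fin (M₂ + M₂)) (Fin (M₂ + M₂)) (LocalRing L v) :=
    ((P⁻¹ : GL (Fin (M₂ + M₂)) (Fp L)) : Matrix (Fin (M₂ + M₂)) (Fin (M₂ + M₂)) (Fp L)).map φ with hPi
  set X := Matrix.reindex (epsV e eW e') (epsV e eW e') (t ⊗ₖ (1 : Matrix (Fin M₂) (Fin M₂) (LocalRing L v))) with hX
  set S := gramS (Fp L) L v (M₂ + M₂) (gramR L e' dV hdV (tensorFrame L dW eW dV') (tensorFrame_real L dW hdW eW dV' hdV')) with hS
  have hPP : Pv * Pi = 1 := by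
    rw [hPv, hPi, ← Matrix.map_mul, ← Units.val_mul, mul_inv_cancel, Units.val_one, Matrix.map_one _ (map_zero _) (map_one _)]
  have hPP' : Pi * Pv = 1 := by
    rw [hPv, hPi, ← Matrix.map_mul, ← Units.val_mul, inv_mul_cancel, Units.val_one, Matrix.map_one _ (map_zero _) (map_one _)]
  have hXskew : (X.map (conjLocal L (IsCMField.complexConj L) v))ᵀ * S + S * X = 0 := skew_reindex_kronecker_one L e dV hdV dW hdW eW e' dV' hdV' v t ht
  have hSfin : gramS (Fp L) L v (M₂ + M₂) (UnitaryGroup.finSum M₂ M₂ T₁ T₂) = Pvᵀ * S * Pv :=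
    gramS_finSum_eq_conj_gramS_tensor L dV hdV dW hdW v eW e' dV' hdV' P hP
  have hPiσ : Pi.map (conjLocal L (IsCMField.complexConj L) v) = Pi := map_conjLocal_of_rational L v _
  have hPvσ : Pv.map (conjLocal L (IsCMField.complexConj L) v) = Pv := map_conjLocal_of_rational L v _
  refine ⟨Pi * X * Pv, ?_, ?_⟩
  · -- `(Pi X Pv)ᴴ (Pvᵀ S Pv) + (Pvᵀ S Pv) (Pi X Pv) = Pvᵀ (Xᴴ S + S X) Pv = 0`
    rw [hSfin, Matrix.map_mul, Matrix.map_mul, hPiσ, hPvσ, Matrix.transpose_mul, Matrix.transpose_mul]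
    have h1 : Pvᵀ * ((X.map (conjLocal L (IsCMField.complexConj L) v))ᵀ * Piᵀ) * (Pvᵀ * S * Pv) =
        Pvᵀ * ((X.map (conjLocal L (IsCMField.complexConj L) v))ᵀ * S) * Pv := by
      rw [show Pvᵀ * ((X.map (conjLocal L (IsCMField.complexConj L) v))ᵀ * Piᵀ) * (Pvᵀ * S * Pv) =
          Pvᵀ * (X.map (conjLocal L (IsCMField.complexConj L) v))ᵀ * (Piᵀ * Pvᵀ) * S * Pv by simp only [Matrix.mul_assoc],
        ← Matrix.transpose_mul Pv Pi, hPP, Matrix.transpose_one, Matrix.mul_one]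
      simp only [Matrix.mul_assoc]
    have h2 : Pvᵀ * S * Pv * (Pi * X * Pv) = Pvᵀ * (S * X) * Pv := by
      rw [show Pvᵀ * S * Pv * (Pi * X * Pv) = Pvᵀ * S * (Pv * Pi) * X * Pv by simp only [Matrix.mul_assoc], hPP, Matrix.mul_one]
      simp only [Matrix.mul_assoc]
    rw [h1, h2, ← Matrix.add_mul, ← Matrix.mul_add, hXskew, Matrix.mul_zero, Matrix.zero_mul]
  · -- `Pv (Pi X Pv) Pi = X`
    rw [show Pv * (Pi * X * Pv) * Pi = (Pv * Pi) * X * (Pv * Pi) by simp only [Matrix.mul_assoc], hPP, Matrix.one_mul, Matrix.mul_one]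

end Block

end Summit.HodgeConjecture.HodgeConjecture.Cruxes.HLiu418.K2LiuTensorMiddleCellSiegelLetters

end
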